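import Summits.Ventures.YMGap.Thresholds.OneLinkLevelTwoOmega
import HarnessLib

/-!
# Venture YMGap — the one-link modulus beyond first order, part 44b: real-arithmetic bookkeeping of the LINEAR-BOOTSTRAP assembly

HONEST FRAMING: venture file of the cell `pub-ymgap` (QuantumFields programme), strong-coupling LATTICE bookkeeping for `SU(N)`
lattice Yang–Mills; nothing about the continuum or the mass gap in the Clay sense.  Pure real arithmetic, no measure, no number of
record: the coefficient identity and the two bookkeeping lemmas that `OneLinkLevelTwoBoot` feeds with the analytic inputs
(`OneLinkRemainderPrimeL2`, `OneLinkSDQuadScale`, `OneLinkOmegaBound`, the split engine and the nested modulus bound).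
* `levelTwo_idCWP`, `levelTwo_m2P`: the cubic-remainder (non-linear part) gradient norm with the quadratic scale `T`;
* `levelTwo_algebraWAQB`: `V ≤ C·(a₀ + E r + 2((E+¼)/N)W + ((3/2)E r² + (2E+¼)T + ((10E+½)/N) r W)/(½−r) + (3/2)E r²·KQ)·L·‖Δ‖_F`.

References: cell note `HOME/p2/ONE-LINK-HIERARCHY.md` §15 (1).
-/

noncomputable section

open scoped Matrix ComplexConjugate BigOperators
open Matrix Complex Finset
open Literature.MathematicalPhysics.QuantumFieldTheory
open Literature.MathematicalPhysics.QuantumFieldTheory.SUNBakryEmery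

namespace Summit.Ventures.YMGap.OneLinkEigen

variable {N : ℕ}

/-! ### Real-arithmetic bookkeeping for the bootstrap assembly (consumed by `OneLinkLevelTwoBoot`) -/

/-- Coefficient identity for the `c₃'` gradient norm with the quadratic scale `T`. [folklore] -/
theorem levelTwo_idCWP (hN : (N : ℝ) ≠ 0) (E W T r : ℝ) :
    3 * (E / 2) * r ^ 2
      + r * (4 * (E / 2) / N + (E / N + 1 / (4 * (N : ℝ))) + 2 * (E / N)) * W
      + r * ((E / N + 1 / (4 * (N : ℝ))) + 4 * (E / N)) * W
      + (2 * (E / 2) / N + 1 / 2 * (E / N + 1 / (4 * (N : ℝ)))) * ((N : ℝ) * T)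
      + 1 / 2 * (E / N + 1 / (4 * (N : ℝ))) * ((N : ℝ) * T) =
      3 / 2 * E * r ^ 2 + (2 * E + 1 / 4) * T + ((10 * E + 1 / 2) / N) * r * W := by
  field_simp
  ring

/-- Bookkeeping for the `c₃'` gradient norm with the quadratic words in `L²`. [folklore] -/
theorem levelTwo_m2P {KW KT CC Nr S r nB nD Z₁ Z₂ WDB WBB Gc W T : ℝ} (hNr : Nr ≠ 0) (hKW : 0 ≤ KW) (hKT : 0 ≤ KT) (hCC : 0 ≤ CC)
    (hr : 0 ≤ r) (hnB : 0 ≤ nB) (hnD : 0 ≤ nD) (hW : 0 ≤ W) (hS : 0 ≤ S) (hNr0 : 0 ≤ Nr)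
    (F1 : Z₁ ≤ W) (F2 : nB * Z₂ ≤ nD * W) (F4 : S * nB ≤ Nr * r) (Q1 : WBB ≤ Nr * T) (Q2 : nB * WDB ≤ nD * (Nr * T))
    (hc : Gc ≤ 3 * KW * r ^ 2 * nD
        + nD * r * (4 * KW / Nr + (KT + CC) + 2 * KT) * Z₁
        + nB * ((KT + CC) * r + 2 * KT * r + 2 * KT / Nr * S * nB) * Z₂
        + nB * (2 * KW / Nr + 1 / 2 * (KT + CC)) * WDB
        + nD * (1 / 2 * (KT + CC)) * WBB) :
    Gc ≤ nD * (3 * KW * r ^ 2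
      + r * (4 * KW / Nr + (KT + CC) + 2 * KT) * W + r * ((KT + CC) + 4 * KT) * W
      + (2 * KW / Nr + 1 / 2 * (KT + CC)) * (Nr * T) + 1 / 2 * (KT + CC) * (Nr * T)) := by
  have u2 : nD * r * (4 * KW / Nr + (KT + CC) + 2 * KT) * Z₁ ≤ nD * r * (4 * KW / Nr + (KT + CC) + 2 * KT) * W :=
    mul_le_mul_of_nonneg_left F1 (by positivity)
  have hβ0 : 0 ≤ (KT + CC) * r + 2 * KT * r + 2 * KT / Nr * S * nB := by positivity
  have u3a : nB * ((KT + CC) * r + 2 * KT * r + 2 * KT / Nr * S * nB) * Z₂ ≤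
      ((KT + CC) * r + 2 * KT * r + 2 * KT / Nr * S * nB) * (nD * W) := by
    have e : nB * ((KT + CC) * r + 2 * KT * r + 2 * KT / Nr * S * nB) * Z₂ =
        ((KT + CC) * r + 2 * KT * r + 2 * KT / Nr * S * nB) * (nB * Z₂) := by ring
    rw [e]; exact mul_le_mul_of_nonneg_left F2 hβ0
  have u3b : (KT + CC) * r + 2 * KT * r + 2 * KT / Nr * S * nB ≤ (KT + CC) * r + 2 * KT * r + 2 * KT * r := by
    have h1 : 2 * KT / Nr * (S * nB) ≤ 2 * KT / Nr * (Nr * r) := mul_le_mul_of_nonneg_left F4 (by positivity)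
    have e1 : 2 * KT / Nr * (Nr * r) = 2 * KT * r := by rw [div_mul_eq_mul_div, div_eq_iff hNr]; ring
    have e2 : 2 * KT / Nr * S * nB = 2 * KT / Nr * (S * nB) := by ring
    rw [e2]; linarith only [h1, e1]
  have u3 : nB * ((KT + CC) * r + 2 * KT * r + 2 * KT / Nr * S * nB) * Z₂ ≤
      ((KT + CC) * r + 2 * KT * r + 2 * KT * r) * (nD * W) :=
    u3a.trans (mul_le_mul_of_nonneg_right u3b (mul_nonneg hnD hW))
  have u4 : nB * (2 * KW / Nr + 1 / 2 * (KT + CC)) * WDB ≤ (2 * KW / Nr + 1 / 2 * (KT + CC)) * (nD * (Nr * T)) := by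
    have e : nB * (2 * KW / Nr + 1 / 2 * (KT + CC)) * WDB = (2 * KW / Nr + 1 / 2 * (KT + CC)) * (nB * WDB) := by ring
    rw [e]; exact mul_le_mul_of_nonneg_left Q2 (by positivity)
  have u5 : nD * (1 / 2 * (KT + CC)) * WBB ≤ nD * (1 / 2 * (KT + CC)) * (Nr * T) := mul_le_mul_of_nonneg_left Q1 (by positivity)
  simp only [div_eq_mul_inv] at hc u2 u3 u4 u5 ⊢
  linarith only [hc, u2, u3, u4, u5]

/-! ### The real-arithmetic assembly with the nested linear term -/

/-- **Assembly of the bootstrap bound** (pure real arithmetic): A-part `a₀`, second-moment scale `W`, quadratic scale `T`, and the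
nested linear term `VM ≤ KQ·L·‖M_ℓ‖_F`, `‖M_ℓ‖_F ≤ nD(κ_w r² + κ_t nB²)`. [folklore] -/
theorem levelTwo_algebraWAQB (hN : 3 ≤ N) {r nB nD L Z₁ Z₂ WDB WBB GΨ Gc V VM S C W T KW KT CC E a0 KQ nM : ℝ}
    (hS : S = Real.sqrt N) (hCdef : C = (N : ℝ) ^ 2 / ((N : ℝ) ^ 2 - 1))
    (hKW : KW = (N : ℝ) ^ 2 / (4 * ((N : ℝ) ^ 2 - 4))) (hKT : KT = (N : ℝ) / (2 * ((N : ℝ) ^ 2 - 4)))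
    (hCC : CC = 1 / (4 * (N : ℝ))) (hE : E = (N : ℝ) ^ 2 / (2 * ((N : ℝ) ^ 2 - 4)))
    (hr0 : 0 ≤ r) (hr : r < 1 / 2) (hnB0 : 0 ≤ nB) (hnD0 : 0 ≤ nD) (hL : 0 ≤ L) (hnB : nB ≤ S * r)
    (hW0 : 0 ≤ W) (F1 : Z₁ ≤ W) (F2 : nB * Z₂ ≤ nD * W) (Q1 : WBB ≤ (N : ℝ) * T) (Q2 : nB * WDB ≤ nD * ((N : ℝ) * T))
    (hKQ : 0 ≤ KQ) (hnM : nM ≤ nD * (KW * r ^ 2 + KT * nB ^ 2)) (hVM : VM ≤ KQ * L * nM)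
    (hΨ : GΨ ≤ (nD * a0 + KW * (2 * r * nD)) + (KT + CC) * nD * Z₁ + (KT + CC) * nB * Z₂)
    (hc : Gc ≤ 3 * KW * r ^ 2 * nD
        + nD * r * (4 * KW / N + (KT + CC) + 2 * KT) * Z₁
        + nB * ((KT + CC) * r + 2 * KT * r + 2 * KT / N * S * nB) * Z₂
        + nB * (2 * KW / N + 1 / 2 * (KT + CC)) * WDB
        + nD * (1 / 2 * (KT + CC)) * WBB)
    (hcov : V ≤ C * L * (GΨ + Gc / (1 / 2 - r)) + C * VM) :
    V ≤ C * (a0 + E * r + 2 * ((E + 1 / 4) / N) * W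
          + (3 / 2 * E * r ^ 2 + (2 * E + 1 / 4) * T + ((10 * E + 1 / 2) / N) * r * W) / (1 / 2 - r)
          + 3 / 2 * E * r ^ 2 * KQ) * L * nD := by
  have h3 : (3 : ℝ) ≤ N := by exact_mod_cast hN
  have hN4 : (0 : ℝ) < (N : ℝ) ^ 2 - 4 := by nlinarith only [h3]
  have hN1 : (0 : ℝ) < (N : ℝ) ^ 2 - 1 := by nlinarith only [h3]
  have hNpos : (0 : ℝ) < N := by linarith only [h3]
  have hNne : (N : ℝ) ≠ 0 := hNpos.ne'
  have hT : 0 < 1 / 2 - r := by linarith only [hr]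
  have hSpos : 0 < S := by rw [hS]; exact Real.sqrt_pos.2 hNpos
  have hS2 : S * S = N := by rw [hS]; exact Real.mul_self_sqrt hNpos.le
  have hC0 : 0 ≤ C := by rw [hCdef]; exact div_nonneg (by positivity) hN1.le
  have hKW0 : 0 ≤ KW := by rw [hKW]; positivity
  have hKT0 : 0 ≤ KT := by rw [hKT]; positivity
  have hCC0 : 0 ≤ CC := by rw [hCC]; positivity
  have hK1 : 0 ≤ KT + CC := add_nonneg hKT0 hCC0
  have eKW : KW = E / 2 := by rw [hKW, hE]; field_simp; try ring
  have eKT : KT = E / N := by rw [hKT, hE]; field_simp; try ring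
  have F3 : nB ^ 2 ≤ N * r ^ 2 := by
    calc nB ^ 2 ≤ (S * r) ^ 2 := pow_le_pow_left₀ hnB0 hnB 2
      _ = (S * S) * r ^ 2 := by ring
      _ = N * r ^ 2 := by rw [hS2]
  have F4 : S * nB ≤ N * r := by
    calc S * nB ≤ S * (S * r) := mul_le_mul_of_nonneg_left hnB hSpos.le
      _ = (S * S) * r := by ring
      _ = N * r := by rw [hS2]
  have m1' := levelTwo_m1 hK1 hnD0 F1 F2 hΨ
  have m1 : GΨ ≤ nD * (a0 + 2 * KW * r + 2 * (KT + CC) * W) := m1'.trans (le_of_eq (by ring))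
  have m2 := levelTwo_m2P hNne hKW0 hKT0 hCC0 hr0 hnB0 hnD0 hW0 hSpos.le hNpos.le F1 F2 F4 Q1 Q2 hc
  -- the nested term: nM ≤ nD (KW r² + KT nB²) ≤ nD (KW + N KT) r²
  have m3 : VM ≤ KQ * L * (nD * ((KW + N * KT) * r ^ 2)) := by
    have h1 : nD * (KW * r ^ 2 + KT * nB ^ 2) ≤ nD * ((KW + N * KT) * r ^ 2) := by
      refine mul_le_mul_of_nonneg_left ?_ hnD0
      nlinarith only [F3, hKT0]
    exact hVM.trans (mul_le_mul_of_nonneg_left (hnM.trans h1) (mul_nonneg hKQ hL))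
  have hsum : GΨ + Gc / (1 / 2 - r) ≤ nD * (a0 + 2 * KW * r + 2 * (KT + CC) * W)
      + nD * (3 * KW * r ^ 2
        + r * (4 * KW / N + (KT + CC) + 2 * KT) * W + r * ((KT + CC) + 4 * KT) * W
        + (2 * KW / N + 1 / 2 * (KT + CC)) * ((N : ℝ) * T) + 1 / 2 * (KT + CC) * ((N : ℝ) * T)) / (1 / 2 - r) :=
    add_le_add m1 (div_le_div_of_nonneg_right m2 hT.le)
  have hCL : 0 ≤ C * L := mul_nonneg hC0 hL
  have hmain : V ≤ C * L * (nD * (a0 + 2 * KW * r + 2 * (KT + CC) * W)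
      + nD * (3 * KW * r ^ 2
        + r * (4 * KW / N + (KT + CC) + 2 * KT) * W + r * ((KT + CC) + 4 * KT) * W
        + (2 * KW / N + 1 / 2 * (KT + CC)) * ((N : ℝ) * T) + 1 / 2 * (KT + CC) * ((N : ℝ) * T)) / (1 / 2 - r))
      + C * (KQ * L * (nD * ((KW + N * KT) * r ^ 2))) :=
    hcov.trans (add_le_add (mul_le_mul_of_nonneg_left hsum hCL) (mul_le_mul_of_nonneg_left m3 hC0))
  rw [eKW, eKT, hCC, levelTwo_idAWA hNne, levelTwo_idCWP hNne] at hmain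
  refine hmain.trans (le_of_eq ?_)
  field_simp
  ring

end Summit.Ventures.YMGap.OneLinkEigen
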